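import Mathlib
import Summits.Ventures.PercRepro2.TypedTriangleTwo

/-!
# A THREE-copy vanishing rule of the symmetrised kernel on states (blind cell PercRepro2, night-3
g18, 2026-08-28; `proofs/NIGHT3-CERT.md` §27.16)

g14's vanishing rules of `KBsym` are two-copy conditions (`KBsym_eq_zero_of_two_Lo3`: two states with
`o, a₃ ∈ C(a₁)`). The equality locus of (ROOT-MONO-o) at `a ≤ 5` (§27.16) left twenty type-2
four-cycles `a₁ – b – o – a₃ – a₂` whose mechanism is a genuinely three-copy condition:

* `KBsym_eq_zero_of_Lo3_H3_Ho3` — one state with `o, a₃ ∈ C(a₁)`, one with `a₃ ∈ C(a₂)` (`o`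
  anywhere), one with `o, a₃ ∈ C(a₂)`: `KBsym = 0` (2,048 cases, `decide`); the two-copy pair
  «`o, a₃ ∈ C(a₁)` in one state, `o, a₃ ∈ C(a₂)` in another» alone does NOT vanish (36 nonzero
  realisable triples, §27.16), nor does the variant with the middle state carrying `o ∈ C(a₁)`
  instead (18);
* `KBsym_eq_zero_of_Ho3_L3_Lo3` — the `l ↔ h` mirror.

Recorded for the equality-locus classification (the graph-level four-cycle theorem is not written
here — an 81-pattern case analysis). Own work; standard axioms.
-/

namespace Summit.Ventures.PercRepro2

namespace CovForm

namespace Triangle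

open OneTyped Untouched

section States

/-- **Three-copy vanishing**: `x` with `o, a₃ ∈ C(a₁)`, `y` with `a₃ ∈ C(a₂)`, `z` with
`o, a₃ ∈ C(a₂)` kill the symmetrised kernel (2,048 cases). -/
theorem KBsym_eq_zero_of_Lo3_H3_Ho3 (q Lb Hb q' Lo' Lb' Ho' Hb' q'' Lb'' Hb'' : Bool) :
    KBsym (mkSt q true Lb true false Hb false) (mkSt q' Lo' Lb' false Ho' Hb' true)
      (mkSt q'' false Lb'' false true Hb'' true) = 0 := by
  revert q Lb Hb q' Lo' Lb' Ho' Hb' q'' Lb'' Hb''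
  decide +kernel

/-- The `l ↔ h` mirror: `x` with `o, a₃ ∈ C(a₂)`, `y` with `a₃ ∈ C(a₁)`, `z` with
`o, a₃ ∈ C(a₁)`. -/
theorem KBsym_eq_zero_of_Ho3_L3_Lo3 (q Lb Hb q' Lo' Lb' Ho' Hb' q'' Lb'' Hb'' : Bool) :
    KBsym (mkSt q false Lb false true Hb true) (mkSt q' Lo' Lb' true Ho' Hb' false)
      (mkSt q'' true Lb'' true false Hb'' false) = 0 := by
  revert q Lb Hb q' Lo' Lb' Ho' Hb' q'' Lb'' Hb''
  decide +kernel

end States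

end Triangle

end CovForm

end Summit.Ventures.PercRepro2
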